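import Summits.BirchSwinnertonDyer.BirchSwinnertonDyer.Theses.KatoDescentPotSupersingular
import Summits.BirchSwinnertonDyer.BirchSwinnertonDyer.Theorems.KatoDescentTamePotSupersingularTameLowerHalfCMRows
import Summits.BirchSwinnertonDyer.BirchSwinnertonDyer.Theorems.KatoDescentPotSupersingularWildLowerHalfRankZero
import HarnessLib

/-!
# Route `KatoDescentPotSupersingular` (rung K9, cell `bsd-potss`): the CM ROWS of the crux
# `WildLowerHalfRankZero` (L₀, item stmt-BirchSwinnertonDyer-19195) are IN PRINT — the crux reduces
# BY NAME to its non-CM rows (a `--supports … --as helper` file)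

The crux L₀ quantifies over EVERY globally minimal `W/ℚ` of analytic rank `0` with `ClassO6 W 3`
(additive, potentially supersingular, WILD at `3`), CM curves included: the leaf `Additive.O6Sharp`
carries no `¬ HasCM` binder, while the class-closure census of the cell (1 770 intrinsic classes,
evidence WILD-L0-CENSUS.md on the item) is taken over the NON-CM domain. The CM wild rows are a
genuine infinite family — every curve with CM by an order of `ℚ(√−3)` (`j ∈ {0, 54000, −12288000}`:
`y² = x³ + k` and its `3`-isogenous partners) whose conductor exponent at `3` is `≥ 3`, e.g. `27a`,
`243a`, `972a` — and on them the lower half (indeed the whole `3`-part) is a PUBLISHED theorem: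
Burungale–Flach 2024 Thm. 1.1 + Cor. 2 prove the full BSD formula for a CM curve `E/ℚ` with
`L(E,1) ≠ 0` at EVERY prime, `p = 3 ∣ #𝓞_K^×` included (completing Rubin 1991 Thm. 11.1) — the
tree's named fact `bsdTriple_of_hasCM_of_L_one_ne_zero` (bsd.S28, row C8 of the partition), consumed
with modularity (to read `r_an = 0` as `L(E,1) ≠ 0`) through `bsdp_cm_rankZero` /
`missingPPartAt_of_bsdp`, exactly as the sibling rung K8-t′ did for its crux
(`Theorems.tameMissingPPartAt_rankZero_of_hasCM`, which carries no reduction-type hypothesis and is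
REUSED here, not restated).

Contents: §1 `wildMissingPPartAt_cmRows` / `wildLowerHalf_cmRows` (the CM rows of O6 at `r_an = 0`:
both halves, hence L₀); §2 the two RESIDUAL stubs of the registered skeleton v3 (planner g10,
2026-08-26T03:35Z) cut by CM — `Sig.stub_lower_red_intrinsic` (reducible intrinsic classes; every wild
CM row is reducible mod `3`) and `Sig.stub_lower_irred_residual` each follow from the two published CM
inputs and THEIR OWN NON-CM ROWS (displayed hypotheses, verbatim binders + `¬ W.HasCM`); §3 the crux
BY NAME from `hCM`, `hmod` and its non-CM rows (`wildLowerHalfRankZero_of_cmFacts_of_nonCM`), and the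
skeleton-v3 composition with the CM cut (`wildLowerHalfRankZero_of_v3Stubs_nonCM`: cite-level inputs +
Burungale–Flach + the FW-locus and Kim-row stubs verbatim + the two residual stubs on their non-CM rows
⟹ the crux, the unit-member classes through generation 0's `missingLowerBoundAt_wild_of_isIsogenous_unit`).

CONDITIONAL (audit `proof.conditional`): `hCM` (Burungale–Flach) and `hmod` (modularity) are published
named facts, the `hnonCM` hypotheses are the open residue (Kato's Conj. 12.10 at `3` for non-CM wild
curves; nothing in print off the Fouquet–Wan locus); the item is NOT closed; nothing is booked.
Seat `bsd-potss-k9-c2` (prover-bsd-potss-k9-c2-g2-0), generation 2.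

References: [BurungaleFlach2024] Thm. 1.1 and Cor. 2 (p. 4); [Rubin1991MainConj] Thm. 11.1;
[Miller2011LMS] §1, Def. 1.1; [Kato2004Asterisque] Conj. 12.10 (p. 224).
-/

set_option autoImplicit false
-- sibling precedent (`KatoDescentPotSupersingularAssembly.lean`): the directory name repeats the summit name
set_option linter.dupNamespace false

noncomputable section

open scoped Classical

namespace Summit.BirchSwinnertonDyer.BirchSwinnertonDyer.Theorems

open WeierstrassCurve Literature.NumberTheory.EllipticCurves
  Literature.NumberTheory.EllipticCurves.Rank1Residual
  Literature.NumberTheory.EllipticCurves.Rank1Residual.Typed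
  Summit.BirchSwinnertonDyer.Rank1Residual.Additive
  Summit.BirchSwinnertonDyer.Rank1Residual
  Summit.BirchSwinnertonDyer.BirchSwinnertonDyer.Theses.KatoDescentPotSupersingular

/-! ## §1 The CM rows of the wild class at analytic rank `0` -/

/-- **CM wild rows, `r_an = 0`: `ord₃ #Ш = ord₃ #Ш_an`** (`MissingPPartAt W 3`, both halves) on every
O6 pair WITH CM, from the CM triple `bsdTriple_of_hasCM_of_L_one_ne_zero` (Burungale–Flach 2024
Thm. 1.1 + Cor. 2: RANK ∧ SHAFIN ∧ LEAD for a CM curve with `L(E,1) ≠ 0`, at every prime including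
`3 ∣ #𝓞_K^×`) read at `r_an = 0` by modularity `hmod` — the sibling rung's
`tameMissingPPartAt_rankZero_of_hasCM` (no reduction-type hypothesis) at `p = 3`. Conditional on the
two published facts. [cite: BurungaleFlach2024, Thm. 1.1 and Cor. 2 (p. 4)] [cite: Miller2011LMS, §1 and Def. 1.1] -/
theorem wildMissingPPartAt_cmRows (hCM : bsdTriple_of_hasCM_of_L_one_ne_zero)
    (hmod : hasEntireLFunction_rat) :
    ∀ (W : WeierstrassCurve ℚ) [W.IsElliptic] [W.IsGloballyMinimal] [Fact (3 : ℕ).Prime],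
      W.analyticRank = 0 → ClassO6 W 3 → W.HasCM → MissingPPartAt W 3 :=
  fun W _ _ _ hr _ hcm ↦ tameMissingPPartAt_rankZero_of_hasCM hCM hmod W 3 hr hcm

/-- **The CM rows of the crux L₀** (`ord₃ #Ш_an ≤ ord₃ #Ш` on the O6 pairs of analytic rank `0` WITH
CM): in print, by `wildMissingPPartAt_cmRows`. Conditional on `hCM`, `hmod`.
[cite: BurungaleFlach2024, Thm. 1.1 and Cor. 2 (p. 4)] [cite: Miller2011LMS, Def. 1.1] -/
theorem wildLowerHalf_cmRows (hCM : bsdTriple_of_hasCM_of_L_one_ne_zero)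
    (hmod : hasEntireLFunction_rat) :
    ∀ (W : WeierstrassCurve ℚ) [W.IsElliptic] [W.IsGloballyMinimal] [Fact (3 : ℕ).Prime],
      W.analyticRank = 0 → ClassO6 W 3 → W.HasCM → MissingLowerBoundAt W 3 :=
  fun W _ _ _ hr hO hcm ↦
    (lower_and_upper_of_missingPPartAt W 3 (wildMissingPPartAt_cmRows hCM hmod W hr hO hcm)).1

/-! ## §2 The two residual stubs of skeleton v3, cut by CM

The registered skeleton v3 of the item (planner bsd-potss-plan g10, evidence 2026-08-26T03:35Z) states
its open stubs on INTRINSIC classes (`Intrinsic W`: every globally minimal isogenous member has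
`0 < ord₃ #Ш_an`). Both residual stubs contain CM rows (a wild CM curve has `E[3]` reducible — CM by an
order of `ℚ(√−3)`, `3` ramified — so its rows sit in `stub_lower_red_intrinsic`; `stub_lower_irred_residual`
is cut the same way for uniformity), and those rows are discharged by §1: each stub follows from the
published CM inputs and ITS OWN NON-CM ROWS. The skeleton's abbreviations `Intrinsic W` and `KimRows W`
are written out (the registered `Sig.stub_*` unfold to exactly these binders). -/

/-- **`Sig.stub_lower_red_intrinsic` from the published CM inputs and its NON-CM rows.** The registered
stub (L₀ on the reducible-mod-`3` intrinsic wild rank-`0` classes) follows from Burungale–Flach (`hCM`),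
modularity (`hmod`) and the displayed hypothesis `hnonCM` = the same statement on the rows with
`¬ W.HasCM` — the honest open residue of the stub (Kato's Conj. 12.10 at `3` at the torsion-free member
of a non-CM reducible intrinsic class; census: 144 such classes, e.g. 15606bn, 17442g). For the tenure
planner: the stub may carry `¬ W.HasCM`. Conditional; nothing credited.
[cite: BurungaleFlach2024, Thm. 1.1 and Cor. 2 (p. 4)] [cite: Kato2004Asterisque, Conj. 12.10 (p. 224)] -/
theorem lower_red_intrinsic_of_cmFacts_of_nonCM (hCM : bsdTriple_of_hasCM_of_L_one_ne_zero)
    (hmod : hasEntireLFunction_rat)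
    (hnonCM : ∀ (W : WeierstrassCurve ℚ) [W.IsElliptic] [W.IsGloballyMinimal] [Fact (3 : ℕ).Prime],
      W.analyticRank = 0 → ClassO6 W 3 → ¬ Irr W 3 → ¬ W.HasCM →
      (∀ (W' : WeierstrassCurve ℚ) [W'.IsElliptic] [W'.IsGloballyMinimal], IsIsogenous W W' →
        ∀ q' : ℚ, shaAn W' = (q' : ℂ) → 0 < padicValRat 3 q') → MissingLowerBoundAt W 3) :
    ∀ (W : WeierstrassCurve ℚ) [W.IsElliptic] [W.IsGloballyMinimal] [Fact (3 : ℕ).Prime],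
      W.analyticRank = 0 → ClassO6 W 3 → ¬ Irr W 3 →
      (∀ (W' : WeierstrassCurve ℚ) [W'.IsElliptic] [W'.IsGloballyMinimal], IsIsogenous W W' →
        ∀ q' : ℚ, shaAn W' = (q' : ℂ) → 0 < padicValRat 3 q') → MissingLowerBoundAt W 3 := by
  intro W _ _ _ hr hO hI hint
  by_cases hcm : W.HasCM
  · exact wildLowerHalf_cmRows hCM hmod W hr hO hcm
  · exact hnonCM W hr hO hI hcm hint

/-- **`Sig.stub_lower_irred_residual` from the published CM inputs and its NON-CM rows** (same cut; the
CM rows of this stub are discharged by §1 whether or not they occur). For the tenure planner: the stub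
may carry `¬ W.HasCM`. Conditional; nothing credited.
[cite: BurungaleFlach2024, Thm. 1.1 and Cor. 2 (p. 4)] [cite: Kato2004Asterisque, Conj. 12.10 (p. 224)] -/
theorem lower_irred_residual_of_cmFacts_of_nonCM (hCM : bsdTriple_of_hasCM_of_L_one_ne_zero)
    (hmod : hasEntireLFunction_rat)
    (hnonCM : ∀ (W : WeierstrassCurve ℚ) [W.IsElliptic] [W.IsGloballyMinimal] [Fact (3 : ℕ).Prime],
      W.analyticRank = 0 → ClassO6 W 3 → Irr W 3 → ¬ (LocIrr W 3 ∧ FWNonsplitRam W 3) →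
      ¬ ((∀ n : ℕ, W.HasSurjectiveModNGaloisRep (3 ^ n : ℕ)) ∧
        Nat.card {Q : (W.baseChange ℚ_[3]).toAffine.Point // (3 : ℕ) • Q = 0} = 1 ∧
        ¬ 3 ∣ W.tamagawaProduct) → ¬ W.HasCM →
      (∀ (W' : WeierstrassCurve ℚ) [W'.IsElliptic] [W'.IsGloballyMinimal], IsIsogenous W W' →
        ∀ q' : ℚ, shaAn W' = (q' : ℂ) → 0 < padicValRat 3 q') → MissingLowerBoundAt W 3) :
    ∀ (W : WeierstrassCurve ℚ) [W.IsElliptic] [W.IsGloballyMinimal] [Fact (3 : ℕ).Prime],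
      W.analyticRank = 0 → ClassO6 W 3 → Irr W 3 → ¬ (LocIrr W 3 ∧ FWNonsplitRam W 3) →
      ¬ ((∀ n : ℕ, W.HasSurjectiveModNGaloisRep (3 ^ n : ℕ)) ∧
        Nat.card {Q : (W.baseChange ℚ_[3]).toAffine.Point // (3 : ℕ) • Q = 0} = 1 ∧
        ¬ 3 ∣ W.tamagawaProduct) →
      (∀ (W' : WeierstrassCurve ℚ) [W'.IsElliptic] [W'.IsGloballyMinimal], IsIsogenous W W' →
        ∀ q' : ℚ, shaAn W' = (q' : ℂ) → 0 < padicValRat 3 q') → MissingLowerBoundAt W 3 := by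
  intro W _ _ _ hr hO hI hloc hK hint
  by_cases hcm : W.HasCM
  · exact wildLowerHalf_cmRows hCM hmod W hr hO hcm
  · exact hnonCM W hr hO hI hloc hK hcm hint

/-! ## §3 The crux BY NAME, reduced to its non-CM rows -/

/-- **`WildLowerHalfRankZero` from the published CM inputs and its NON-CM rows.** Granted
Burungale–Flach (`hCM`) and modularity (`hmod`), the crux follows from the displayed hypothesis
`hnonCM` = the lower half on the NON-CM O6 rows of analytic rank `0` — the honest open residue (Kato's
Main Conjecture 12.10 at the wild prime `3` of a non-CM curve; claimed on the Fouquet–Wan locus by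
arXiv:2107.13726, PRE; nothing in print off it). Conditional; the item is NOT closed.
[cite: BurungaleFlach2024, Thm. 1.1 and Cor. 2 (p. 4)] [cite: Kato2004Asterisque, Conj. 12.10 (p. 224)] -/
theorem wildLowerHalfRankZero_of_cmFacts_of_nonCM (hCM : bsdTriple_of_hasCM_of_L_one_ne_zero)
    (hmod : hasEntireLFunction_rat)
    (hnonCM : ∀ (W : WeierstrassCurve ℚ) [W.IsElliptic] [W.IsGloballyMinimal] [Fact (3 : ℕ).Prime],
      W.analyticRank = 0 → ClassO6 W 3 → ¬ W.HasCM → MissingLowerBoundAt W 3) :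
    Summit.BirchSwinnertonDyer.BirchSwinnertonDyer.Theses.KatoDescentPotSupersingular.WildLowerHalfRankZero := by
  intro W _ _ _ hr hO
  by_cases hcm : W.HasCM
  · exact wildLowerHalf_cmRows hCM hmod W hr hO hcm
  · exact hnonCM W hr hO hcm

/-- **The skeleton-v3 composition with the CM cut.** From the cite-level stub `Sig.stub_pubInputsO6Core`
(Cassels ∧ GZK ∧ modularity, `hP`), Burungale–Flach (`hCM`), the two road stubs `Sig.stub_lower_irred_fwLocus`
(`hfw`) and `Sig.stub_lower_kimRows` (`hkim`) VERBATIM, and the two residual stubs ON THEIR NON-CM ROWS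
(`hres`, `hred`: the registered signatures with `¬ W.HasCM` inserted), the crux BY NAME: unit-member
classes by generation 0's `missingLowerBoundAt_wild_of_isIsogenous_unit`, CM rows by §1, the rest by the
case split of the registered `WildLowerHalfRankZero_of`. So a skeleton v4 whose residual stubs carry
`¬ W.HasCM` composes (this theorem is its `_of`, modulo the extra published input `hCM`). Conditional;
the item is NOT closed. [cite: BurungaleFlach2024, Thm. 1.1 and Cor. 2 (p. 4)] [cite: MilneADT2006, Thm. I.7.3]
[cite: Kato2004Asterisque, Conj. 12.10 (p. 224)] -/
theorem wildLowerHalfRankZero_of_v3Stubs_nonCM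
    (hP : bsdRHS_eq_of_isIsogenous ∧ rank_eq_analyticRank_of_analyticRank_le_one ∧ hasEntireLFunction_rat)
    (hCM : bsdTriple_of_hasCM_of_L_one_ne_zero)
    (hfw : ∀ (W : WeierstrassCurve ℚ) [W.IsElliptic] [W.IsGloballyMinimal] [Fact (3 : ℕ).Prime],
      W.analyticRank = 0 → ClassO6 W 3 → Irr W 3 → (LocIrr W 3 ∧ FWNonsplitRam W 3) →
      (∀ (W' : WeierstrassCurve ℚ) [W'.IsElliptic] [W'.IsGloballyMinimal], IsIsogenous W W' →
        ∀ q' : ℚ, shaAn W' = (q' : ℂ) → 0 < padicValRat 3 q') → MissingLowerBoundAt W 3)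
    (hkim : ∀ (W : WeierstrassCurve ℚ) [W.IsElliptic] [W.IsGloballyMinimal] [Fact (3 : ℕ).Prime],
      W.analyticRank = 0 → ClassO6 W 3 →
      ((∀ n : ℕ, W.HasSurjectiveModNGaloisRep (3 ^ n : ℕ)) ∧
        Nat.card {Q : (W.baseChange ℚ_[3]).toAffine.Point // (3 : ℕ) • Q = 0} = 1 ∧
        ¬ 3 ∣ W.tamagawaProduct) → MissingLowerBoundAt W 3)
    (hres : ∀ (W : WeierstrassCurve ℚ) [W.IsElliptic] [W.IsGloballyMinimal] [Fact (3 : ℕ).Prime],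
      W.analyticRank = 0 → ClassO6 W 3 → Irr W 3 → ¬ (LocIrr W 3 ∧ FWNonsplitRam W 3) →
      ¬ ((∀ n : ℕ, W.HasSurjectiveModNGaloisRep (3 ^ n : ℕ)) ∧
        Nat.card {Q : (W.baseChange ℚ_[3]).toAffine.Point // (3 : ℕ) • Q = 0} = 1 ∧
        ¬ 3 ∣ W.tamagawaProduct) → ¬ W.HasCM →
      (∀ (W' : WeierstrassCurve ℚ) [W'.IsElliptic] [W'.IsGloballyMinimal], IsIsogenous W W' →
        ∀ q' : ℚ, shaAn W' = (q' : ℂ) → 0 < padicValRat 3 q') → MissingLowerBoundAt W 3)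
    (hred : ∀ (W : WeierstrassCurve ℚ) [W.IsElliptic] [W.IsGloballyMinimal] [Fact (3 : ℕ).Prime],
      W.analyticRank = 0 → ClassO6 W 3 → ¬ Irr W 3 → ¬ W.HasCM →
      (∀ (W' : WeierstrassCurve ℚ) [W'.IsElliptic] [W'.IsGloballyMinimal], IsIsogenous W W' →
        ∀ q' : ℚ, shaAn W' = (q' : ℂ) → 0 < padicValRat 3 q') → MissingLowerBoundAt W 3) :
    Summit.BirchSwinnertonDyer.BirchSwinnertonDyer.Theses.KatoDescentPotSupersingular.WildLowerHalfRankZero := by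
  intro W _ _ _ hr hO
  by_cases hunit : ∃ (W' : WeierstrassCurve ℚ) (_ : W'.IsElliptic) (_ : W'.IsGloballyMinimal),
      IsIsogenous W W' ∧ ∃ q' : ℚ, shaAn W' = (q' : ℂ) ∧ padicValRat 3 q' ≤ 0
  · obtain ⟨W', hW', hM', hiso, q', hq', hv'⟩ := hunit
    haveI := hW'
    haveI := hM'
    exact missingLowerBoundAt_wild_of_isIsogenous_unit hP.1 hP.2.1 hP.2.2 W hr hO W' hiso hq' hv'
  · have hnon : ∀ (W' : WeierstrassCurve ℚ) [W'.IsElliptic] [W'.IsGloballyMinimal], IsIsogenous W W' →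
        ∀ q' : ℚ, shaAn W' = (q' : ℂ) → 0 < padicValRat 3 q' :=
      fun W' hW' hM' hiso q' hq' ↦ lt_of_not_ge fun hv' ↦ hunit ⟨W', hW', hM', hiso, q', hq', hv'⟩
    by_cases hK : (∀ n : ℕ, W.HasSurjectiveModNGaloisRep (3 ^ n : ℕ)) ∧
        Nat.card {Q : (W.baseChange ℚ_[3]).toAffine.Point // (3 : ℕ) • Q = 0} = 1 ∧
        ¬ 3 ∣ W.tamagawaProduct
    · exact hkim W hr hO hK
    · by_cases hI : Irr W 3
      · by_cases hloc : LocIrr W 3 ∧ FWNonsplitRam W 3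
        · exact hfw W hr hO hI hloc hnon
        · exact lower_irred_residual_of_cmFacts_of_nonCM hCM hP.2.2 hres W hr hO hI hloc hK hnon
      · exact lower_red_intrinsic_of_cmFacts_of_nonCM hCM hP.2.2 hred W hr hO hI hnon

end Summit.BirchSwinnertonDyer.BirchSwinnertonDyer.Theorems

end
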